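import Literature.NumberTheory.QuadraticFields.ThreeTorsion
import Literature.NumberTheory.QuadraticFields.IdealsOfPrimePowerNorm

/-!
# Crux `ArithStatLadder.IqThreeNotPPoly` (stmt-QuantumAdvantage-2422) — stub `stub_nagellThreeTorsion`

Stub F of the line `Sketch`, skeleton v4 (NAGELL PLANTING): **Nagell's explicit ideal class of
order `3`** (T. Nagell, *Über die Klassenzahl imaginär-quadratischer Zahlkörper*, Abh. Math. Sem.
Hamburg 1 (1922) 140–150, §1: if `y² + d = 4a³` with `a > 1`, `4a < d` and `−d` a fundamental
discriminant, then `3 ∣ h(−d)`). It REPLACES the class-field-theoretic socket of v3 (Hasse's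
dictionary): no cubic field and no class field theory enter.

Mathematics. Let `K = ℚ(√−d)`, `(1, ω)` an integral basis with `ω² = m + tω`, `d_K = t² + 4m = −d`
(`t` odd as `d ≡ 3 (mod 4)`), and `k = (t − y)/2`, so that the form `(a, −y, a²)` of discriminant
`y² − 4a³ = −d` has the form ideal `𝔞 = (a, ω − k)`, `N𝔞 = a`, `N(ω − k) = k² − tk − m = a³`.
* `𝔞³ ⊆ (ω − k)`: `𝔞² ⊆ (a², ω − k)` and `a³ = −(ω − k)(ω − (t − k)) ∈ (ω − k)`;
* both sides have absolute norm `a³`, so `𝔞³ = (ω − k)` (Dedekind: `(ω − k) ∣ 𝔞³` with cofactor of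
  norm `1`) and `[𝔞]³ = 1`;
* `𝔞` is not principal: a generator `π = x + yω` would have `4|N(π)| = (2x + ty)² + d y² = 4a < d`,
  forcing `y = 0`, `x² = a`, and then `x ∣ ω − k` in `ℤ ⊕ ℤω` forces `x = ±1`, `a = 1`.
Hence `Cl(K)` has a non-trivial element with `c³ = 1`, i.e. `1 < #Cl(K)[3]`, which is `3 ∣ h(−d)` by
the tree's `three_dvd_classNumber_iff_one_lt_quadFieldThreeTorsion` (`h = BinaryQuadraticForm.classNumber`,
Cox Thm 7.7) and `quadFieldThreeTorsion_eq`.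
-/

set_option linter.dupNamespace false -- D-0017: single-problem summit ⇒ `QuantumAdvantage.QuantumAdvantage` by design

noncomputable section

namespace Summit.QuantumAdvantage.QuantumAdvantage.Theorems.IqThreeNotPPoly

open scoped nonZeroDivisors
open Module NumberField Ideal
open Literature.NumberTheory.QuadraticFields
open Literature.NumberTheory.QuadraticFields.Quadratic

section QuadraticField

variable {K : Type*} [Field K] [NumberField K] (b : Basis (Fin 2) ℤ (𝓞 K)) (hb : b 0 = 1)
  {t m : ℤ} (hω : b 1 * b 1 = (m : 𝓞 K) + (t : 𝓞 K) * b 1)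

omit [NumberField K] in
include hω in
/-- **The cube inclusion.** If `A · A² = k² − tk − m` (the form `(A, 2k − t, A²)` has discriminant
`t² + 4m`), then `(A, ω − k)³ ⊆ (ω − k)`: `(A, η)² ⊆ (A², η)` and `A³ = −η η̄ ∈ (η)`, `η = ω − k`.
[folklore] -/
theorem span_pair_pow_three_le {A k : ℤ} (hn : A * A ^ 2 = k ^ 2 - t * k - m) :
    span {(A : 𝓞 K), b 1 - k} ^ 3 ≤ span {b 1 - (k : 𝓞 K)} := by
  set η : 𝓞 K := b 1 - (k : 𝓞 K) with hη
  -- `A³ ∈ (η)`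
  have hA3 : (A : 𝓞 K) ^ 3 ∈ span {η} := by
    rw [Ideal.mem_span_singleton']
    refine ⟨-(b 1 - ((t - k : ℤ) : 𝓞 K)), ?_⟩
    have hconj := sub_mul_sub_conj_eq b hω k
    have hcast : ((k ^ 2 - t * k - m : ℤ) : 𝓞 K) = (A : 𝓞 K) ^ 3 := by
      rw [← hn]; push_cast; ring
    rw [hcast] at hconj
    rw [hη]
    linear_combination (-1 : 𝓞 K) * hconj
  -- `(A, η)² ⊆ (A², η)`
  have hsq : span {(A : 𝓞 K), η} * span {(A : 𝓞 K), η} ≤ span {(A : 𝓞 K) ^ 2, η} := by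
    rw [Ideal.mul_le]
    intro r hr s hs
    obtain ⟨u, v, rfl⟩ := Ideal.mem_span_pair.1 hr
    obtain ⟨u', v', rfl⟩ := Ideal.mem_span_pair.1 hs
    exact Ideal.mem_span_pair.2 ⟨u * u', u * v' * A + v * u' * A + v * v' * η, by ring⟩
  -- `(A², η)(A, η) ⊆ (η)`
  have hcube : span {(A : 𝓞 K) ^ 2, η} * span {(A : 𝓞 K), η} ≤ span {η} := by
    rw [Ideal.mul_le]
    intro r hr s hs
    obtain ⟨c, e, rfl⟩ := Ideal.mem_span_pair.1 hr
    obtain ⟨u, v, rfl⟩ := Ideal.mem_span_pair.1 hs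
    have h1 : c * u * (A : 𝓞 K) ^ 3 ∈ span {η} := Ideal.mul_mem_left _ _ hA3
    have h2 : (c * v * (A : 𝓞 K) ^ 2 + e * u * A + e * v * η) * η ∈ span {η} :=
      Ideal.mul_mem_left _ _ (Ideal.mem_span_singleton_self η)
    have e1 : (c * (A : 𝓞 K) ^ 2 + e * η) * (u * A + v * η) =
        c * u * (A : 𝓞 K) ^ 3 + (c * v * (A : 𝓞 K) ^ 2 + e * u * A + e * v * η) * η := by ring
    rw [e1]
    exact Ideal.add_mem _ h1 h2
  calc span {(A : 𝓞 K), η} ^ 3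
      = span {(A : 𝓞 K), η} * span {(A : 𝓞 K), η} * span {(A : 𝓞 K), η} := by
        rw [pow_succ, pow_two]
    _ ≤ span {(A : 𝓞 K) ^ 2, η} * span {(A : 𝓞 K), η} := Ideal.mul_mono_left hsq
    _ ≤ span {η} := hcube

include hb hω in
/-- **The cube is principal**: with `A · A² = k² − tk − m` and `A ≠ 0`,
`(A, ω − k)³ = (ω − k)` — both sides have absolute norm `|A|³` (`N(A, ω − k) = |A|`,
`N(ω − k) = k² − tk − m`), and the cofactor in `(A, ω−k)³ = (ω−k)·L` has norm `1`. [folklore] -/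
theorem span_pair_pow_three_eq {A k : ℤ} (hA : A ≠ 0) (hn : A * A ^ 2 = k ^ 2 - t * k - m) :
    span {(A : 𝓞 K), b 1 - k} ^ 3 = span {b 1 - (k : 𝓞 K)} := by
  have hle := span_pair_pow_three_le b hω hn
  -- norms
  have hN𝔞 : absNorm (span {(A : 𝓞 K), b 1 - k}) = A.natAbs :=
    absNorm_span_pair_eq b hb hω (C := A ^ 2) hn
  have hNη : absNorm (span {b 1 - (k : 𝓞 K)}) = A.natAbs ^ 3 := by
    rw [absNorm_span_singleton]
    have e : b 1 - (k : 𝓞 K) = ((-k : ℤ) : 𝓞 K) + ((1 : ℤ) : 𝓞 K) * b 1 := by push_cast; ring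
    rw [e, norm_intCast_add_intCast_mul b hb hω, ← Int.natAbs_pow]
    congr 1
    linear_combination -hn
  obtain ⟨L, hL⟩ := Ideal.dvd_iff_le.2 hle
  have hnorm := congrArg absNorm hL
  rw [map_pow, map_mul, hN𝔞, hNη] at hnorm
  have hA' : A.natAbs ^ 3 ≠ 0 := pow_ne_zero 3 (Int.natAbs_ne_zero.2 hA)
  have hL1 : absNorm L = 1 := by
    have h : A.natAbs ^ 3 * absNorm L = A.natAbs ^ 3 * 1 := by rw [mul_one]; exact hnorm.symm
    exact Nat.eq_of_mul_eq_mul_left (Nat.pos_of_ne_zero hA') h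
  rw [Ideal.absNorm_eq_one_iff] at hL1
  rw [hL, hL1, Ideal.mul_top]

include hb hω in
/-- **Non-principality (Nagell).** If `1 < A`, `t² + 4m < −4A` (i.e. `|d_K| > 4A`) and
`A · C = k² − tk − m`, then `(A, ω − k)` is not principal: a generator `π = x + yω` has
`4·N(π) = (2x + ty)² − (t² + 4m)y² = 4A`, forcing `y = 0`, `x² = A`, and `x ∣ ω − k` in `ℤ ⊕ ℤω`
forces `x = ±1`. [folklore] -/
theorem not_isPrincipal_span_pair {A k C : ℤ} (hA : 1 < A) (hd : t ^ 2 + 4 * m < -(4 * A))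
    (hn : A * C = k ^ 2 - t * k - m) :
    ¬ (span {(A : 𝓞 K), b 1 - k}).IsPrincipal := by
  intro hP
  obtain ⟨π, hπ⟩ := hP
  have hπ' : span {(A : 𝓞 K), b 1 - k} = span {π} := hπ
  -- the norm of the generator
  have hN : (Algebra.norm ℤ π).natAbs = A.natAbs := by
    rw [← absNorm_span_singleton, ← hπ']
    exact absNorm_span_pair_eq b hb hω hn
  obtain ⟨x, y, hxy⟩ : ∃ x y : ℤ, π = (x : 𝓞 K) + (y : 𝓞 K) * b 1 :=
    ⟨_, _, eq_repr_add_repr_mul_of_basis b hb π⟩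
  rw [hxy, norm_intCast_add_intCast_mul b hb hω] at hN
  -- `4 N(π) = (2x + ty)² - (t² + 4m) y²`, so `y = 0` and `x² = A`
  have hA0 : 0 < A := by omega
  have hn' : x ^ 2 + t * x * y - m * y ^ 2 = A ∨ x ^ 2 + t * x * y - m * y ^ 2 = -A :=
    Int.natAbs_eq_natAbs_iff.1 hN
  have h4 : 4 * (x ^ 2 + t * x * y - m * y ^ 2) =
      (2 * x + t * y) ^ 2 - (t ^ 2 + 4 * m) * y ^ 2 := by ring
  have hy : y = 0 := by
    by_contra hy
    have hy2 : 0 < y ^ 2 := lt_of_le_of_ne (sq_nonneg y) (Ne.symm (pow_ne_zero 2 hy))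
    have hy2' : 1 ≤ y ^ 2 := hy2
    have key : (t ^ 2 + 4 * m) * y ^ 2 < -(4 * A) * y ^ 2 := mul_lt_mul_of_pos_right hd hy2
    have key2 : 4 * A * 1 ≤ 4 * A * y ^ 2 := mul_le_mul_of_nonneg_left hy2' (by omega)
    have hsq : 0 ≤ (2 * x + t * y) ^ 2 := sq_nonneg _
    rcases hn' with h | h <;> linarith
  subst hy
  have hx : x ^ 2 = A := by
    have e0 : x ^ 2 + t * x * 0 - m * 0 ^ 2 = x ^ 2 := by ring
    rw [e0] at hn'
    rcases hn' with h | h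
    · exact h
    · nlinarith [sq_nonneg x]
  -- `ω - k ∈ (x)`: `x ∣ ω - k`, impossible in `ℤ ⊕ ℤω` unless `x = ±1`
  have hmem : b 1 - (k : 𝓞 K) ∈ span {π} := by
    rw [← hπ']; exact Ideal.subset_span (by simp)
  rw [hxy, Ideal.mem_span_singleton'] at hmem
  obtain ⟨c, hc⟩ := hmem
  obtain ⟨c₀, c₁, rfl⟩ : ∃ c₀ c₁ : ℤ, c = (c₀ : 𝓞 K) + (c₁ : 𝓞 K) * b 1 :=
    ⟨_, _, eq_repr_add_repr_mul_of_basis b hb c⟩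
  have h' : ((c₀ * x : ℤ) : 𝓞 K) + ((c₁ * x : ℤ) : 𝓞 K) * b 1 =
      ((-k : ℤ) : 𝓞 K) + ((1 : ℤ) : 𝓞 K) * b 1 := by
    push_cast at hc ⊢
    linear_combination hc
  obtain ⟨-, h1⟩ := intCast_add_intCast_mul_inj b hb h'
  have hx1 : x = 1 ∨ x = -1 :=
    Int.isUnit_iff.1 (IsUnit.of_mul_eq_one c₁ (by rw [mul_comm]; exact h1))
  have hA1 : A = 1 := by
    rcases hx1 with rfl | rfl <;> simpa using hx.symm
  omega

include hb hω in
/-- **The class of order `3`.** For `1 < A`, `t² + 4m < −4A` and `A · A² = k² − tk − m`, the class of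
`𝔞 = (A, ω − k)` in `Cl(K)` satisfies `[𝔞]³ = 1`, `[𝔞] ≠ 1`; hence `#Cl(K)[3] > 1`. [folklore] -/
theorem one_lt_natCard_threeTorsion_of_form {A k : ℤ} (hA : 1 < A) (hd : t ^ 2 + 4 * m < -(4 * A))
    (hn : A * A ^ 2 = k ^ 2 - t * k - m) :
    1 < Nat.card {c : ClassGroup (𝓞 K) // c ^ 3 = 1} := by
  set 𝔞 : Ideal (𝓞 K) := span {(A : 𝓞 K), b 1 - k} with h𝔞
  have hA0 : A ≠ 0 := by omega
  have h𝔞0 : 𝔞 ∈ (Ideal (𝓞 K))⁰ := by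
    rw [mem_nonZeroDivisors_iff_ne_zero]
    intro h0
    have hAmem : (A : 𝓞 K) ∈ 𝔞 := Ideal.subset_span (by simp)
    rw [h0] at hAmem
    have hA00 : ((A : ℤ) : 𝓞 K) = 0 := by simpa using hAmem
    exact hA0 (by exact_mod_cast hA00)
  set c : ClassGroup (𝓞 K) := ClassGroup.mk0 ⟨𝔞, h𝔞0⟩ with hc
  have hc3 : c ^ 3 = 1 := by
    have h3 : (⟨𝔞, h𝔞0⟩ : (Ideal (𝓞 K))⁰) ^ 3 = ⟨𝔞 ^ 3, pow_mem h𝔞0 3⟩ := Subtype.ext rfl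
    rw [hc, ← map_pow, h3, ClassGroup.mk0_eq_one_iff, h𝔞, span_pair_pow_three_eq b hb hω hA0 hn]
    exact ⟨⟨b 1 - (k : 𝓞 K), rfl⟩⟩
  have hc1 : c ≠ 1 := by
    rw [hc, Ne, ClassGroup.mk0_eq_one_iff]
    exact not_isPrincipal_span_pair b hb hω (C := A ^ 2) hA hd hn
  rw [Finite.one_lt_card_iff_nontrivial]
  exact ⟨⟨c, hc3⟩, ⟨1, one_pow 3⟩, fun h => hc1 (congrArg Subtype.val h)⟩

end QuadraticField

/-- **STUB F · `stub_nagellThreeTorsion` (Nagell 1922).** If `1 < a`, `4a < d`, `d` squarefree,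
`y` odd and `y² + d = 4a³`, then `3 ∣ h(−d)`: `−d ≡ 1 (mod 4)` is a negative fundamental
discriminant, `K = ℚ(√−d)` has integral basis `(1, ω)`, `ω² = m + tω`, `t² + 4m = −d` (`t` odd),
and with `k = (t − y)/2` the form ideal `(a, ω − k)` of `(a, −y, a²)` is a non-principal ideal class
whose cube is principal (`one_lt_natCard_threeTorsion_of_form`); `3 ∣ h(−d) ↔ 1 < #Cl₃(−d)`
(`three_dvd_classNumber_iff_one_lt_quadFieldThreeTorsion`, `quadFieldThreeTorsion_eq`). -/
theorem stub_nagellThreeTorsion :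
    ∀ (a y d : ℕ), 1 < a → 4 * a < d → Squarefree d → Odd y → y ^ 2 + d = 4 * a ^ 3 →
    3 ∣ BinaryQuadraticForm.classNumber (-(d : ℤ)) := by
  intro a y d ha h4a hsq hy hyd
  obtain ⟨w, rfl⟩ := hy
  -- `d ≡ 3 (mod 4)`
  obtain ⟨e, he⟩ : ∃ e, d = 4 * e + 3 := by
    refine ⟨a ^ 3 - w ^ 2 - w - 1, ?_⟩
    have h1 : (2 * w + 1) ^ 2 + d = 4 * (w ^ 2 + w) + 1 + d := by ring
    rw [h1] at hyd
    generalize a ^ 3 = a3 at hyd ⊢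
    generalize w ^ 2 = w2 at hyd ⊢
    omega
  -- `-d` is a negative fundamental discriminant
  have hD : ((-(d : ℤ)) % 4 = 1 ∧ Squarefree (-(d : ℤ)) ∧ (-(d : ℤ)) ≠ 1) ∨
      (4 ∣ (-(d : ℤ)) ∧ ((-(d : ℤ)) / 4 % 4 = 2 ∨ (-(d : ℤ)) / 4 % 4 = 3) ∧
        Squarefree ((-(d : ℤ)) / 4)) := by
    left
    refine ⟨by omega, ?_, by omega⟩
    rw [← Int.squarefree_natAbs, Int.natAbs_neg, Int.natAbs_natCast]
    exact hsq
  have hD0 : (-(d : ℤ)) < 0 := by omega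
  rw [three_dvd_classNumber_iff_one_lt_quadFieldThreeTorsion hD hD0]
  obtain ⟨K, _, _, h2, hdisc⟩ := exists_numberField_discr_eq hD
  rw [quadFieldThreeTorsion_eq (-(d : ℤ)) K h2 hdisc]
  -- integral basis `(1, ω)`, `ω² = m + tω`, `d_K = t² + 4m`
  obtain ⟨b, hb⟩ := exists_basis_zero_eq_one h2
  have hω := basis_one_mul_self_eq b hb
  have hdK := discr_eq_sq_add_four_mul b hb
  set m : ℤ := b.repr (b 1 * b 1) 0 with hm
  set t : ℤ := b.repr (b 1 * b 1) 1 with ht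
  rw [hdisc] at hdK
  -- `t` is odd
  obtain ⟨r, hr⟩ : Odd t := by
    rcases Int.even_or_odd t with ⟨r, hr⟩ | hodd
    · exfalso
      have h1 : t ^ 2 = 4 * (r * r) := by rw [hr]; ring
      omega
    · exact hodd
  -- `k = (t - y)/2 = r - w`
  have hyd' : ((2 * w + 1 : ℕ) : ℤ) ^ 2 + (d : ℤ) = 4 * (a : ℤ) ^ 3 := by exact_mod_cast hyd
  have hn : (a : ℤ) * (a : ℤ) ^ 2 = (r - w) ^ 2 - t * (r - w) - m := by
    have h4 : 4 * ((a : ℤ) * (a : ℤ) ^ 2) = 4 * ((r - (w : ℤ)) ^ 2 - t * (r - w) - m) := by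
      rw [hr]
      rw [hr] at hdK
      push_cast at hyd'
      linear_combination -hyd' - hdK
    exact mul_left_cancel₀ (by norm_num : (4 : ℤ) ≠ 0) h4
  have hA : (1 : ℤ) < a := by exact_mod_cast ha
  have hd4 : t ^ 2 + 4 * m < -(4 * (a : ℤ)) := by
    rw [← hdK]; omega
  exact one_lt_natCard_threeTorsion_of_form b hb hω (k := r - w) hA hd4 hn

end Summit.QuantumAdvantage.QuantumAdvantage.Theorems.IqThreeNotPPoly

end
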